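import Summits.QuantumFields.YangMills.Theorems.DiagonalMirrorRPRWilsonDiagonalModelPinnedLetters

/-!
# Crux `WeakCouplingHypercubicLimitRP` (stmt-QuantumFields-27398) / aside `DiagonalMirrorRPR` (stmt-QuantumFields-10604), door B,
# construction F1_diag — step A′(iii): the WITNESS ROWS of the transparent model (trace formula for every `m ≥ 2`, disjointness, summable powers)

Helper file (`--supports stmt-QuantumFields-27398 --as helper`) of the hand `hand-10604-wilsonDiagModel-2` g2 (director-ym O4 WORD 40 (3)(β), last clause:
"the witness rows the structure drops — `trace ∀ m ≥ 2`, `hodd`, `hdisj`, `hside` — as THEOREMS about the explicit slice").  The interface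
`DiagonalSliceModel` keeps only `trace_nonneg` / `trace_side_pos`; the transparent model `wilsonDiagonalTransferModel` (✓`…Pinned`) satisfies MORE, and the
door-B ideation (heat-trace letters R2/R2♭, two-shift windows) needs it by name:
* `SlicePkg.toFields_trace` — `Σ' sp^m + (-1)^m Σ' sm^m = diagCyclicTraceU ρ β_k m = Tr K_u^m` for every `m ≥ 2`, with both power series summable;
  `SlicePkg.toFields_disjoint` — `sp j = 0 ∨ sm j = 0` (one sign per index);
* ★ `wilsonDiagonalTransferModel_trace` / `_evenTrace` / `_oddTrace` / `_disjoint` — the same for the model of record at every index with `side_k ≥ 3`;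
  `_top_isGreatest`, `_odd_le`, `_strict_side` — by-name forms of the interface rows (director-ym O4 WORD 44 (1)(c));
  in particular the EVEN heat trace `Σ' sp k ^ (2t+2) + Σ' sm k ^ (2t+2) = Tr K_u^{2t+2}`, the quantity the letters R2 `DiagLukewarm` / R2♭ `DiagTepid`
  normalise by powers of `top_k`.

HONEST FRAMING: identities of the construction; no letter proved; D1′, ⟨27398⟩, S6i, ⟨10604⟩ OPEN; the Yang–Mills mass gap is NOT proved here or anywhere
in the tree.  No definition, no instance, no notation, `autoImplicit false`.

References: K. Osterwalder, E. Seiler, Ann. Phys. 110 (1978) §2–3; B. Simon, *Trace Ideals* (2005) Ch. 3.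
-/

set_option autoImplicit false

noncomputable section

open scoped BigOperators
open MeasureTheory Function Filter Topology
open Literature.MathematicalPhysics.QuantumLattice Literature.MathematicalPhysics.QuantumFieldTheory
open Summit.QuantumFields.YangMills.Cruxes.DiagonalMirrorRPR.ParityBridgeColdTraces

namespace Summit.QuantumFields.YangMills.Cruxes.DiagonalMirrorRPR.SignTwistedDiagonalTrace.WilsonDiagonal

section Rows

variable {G : Type} [Group G] [TopologicalSpace G] [IsTopologicalGroup G] [CompactSpace G] [MeasurableSpace G] [BorelSpace G]
  (r : LatticeRep G) (sch : SpeciesScheme (YMSpecies G))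

/-- **Trace formula of the explicit slice, every `m ≥ 2`**: `Σ' sp^m + (-1)^m Σ' sm^m = Tr K_u^m` (both series summable). -/
theorem SlicePkg.toFields_trace {k : ℕ} (hβ : 0 ≤ sch.β k) (h3 : 3 ≤ sch.side k) (P : SlicePkg (sch.side k) G r.N r.ρ (sch.β k))
    (m : ℕ) [NeZero m] (hm : 2 ≤ m) :
    Summable (fun j => (SlicePkg.toFields r sch hβ h3 P).sp j ^ m) ∧ Summable (fun j => (SlicePkg.toFields r sch hβ h3 P).sm j ^ m) ∧
      ∑' j, (SlicePkg.toFields r sch hβ h3 P).sp j ^ m + (-1) ^ m * ∑' j, (SlicePkg.toFields r sch hβ h3 P).sm j ^ m =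
        diagCyclicTraceU r.ρ (sch.β k) m (S := sch.side k) (G := G) := by
  rw [SlicePkg.toFields_sp, SlicePkg.toFields_sm]
  exact (Classical.choose_spec (SlicePkg.spectral r sch h3 P)).2.2.2.2.2.2.2.2.2.1 m hm

/-- **One sign per index**: `sp j = 0 ∨ sm j = 0` for the explicit slice. -/
theorem SlicePkg.toFields_disjoint {k : ℕ} (hβ : 0 ≤ sch.β k) (h3 : 3 ≤ sch.side k) (P : SlicePkg (sch.side k) G r.N r.ρ (sch.β k))
    (j : ℕ) : (SlicePkg.toFields r sch hβ h3 P).sp j = 0 ∨ (SlicePkg.toFields r sch hβ h3 P).sm j = 0 := by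
  rw [SlicePkg.toFields_sp, SlicePkg.toFields_sm]
  exact (Classical.choose_spec (SlicePkg.spectral r sch h3 P)).2.2.2.2.2.2.2.2.1 j

/-- At an index with `side_k ≥ 3` the model of record's slice IS the explicit slice of the eigen-package at `k`. -/
theorem pinnedSliceFields_eq (hβ : ∀ k, 0 ≤ sch.β k) (k : ℕ) (h3 : 3 ≤ sch.side k) :
    pinnedSliceFields r sch hβ k = SlicePkg.toFields r sch (hβ k) h3 (slicePkgAt r sch hβ k) := by
  unfold pinnedSliceFields
  rw [dif_pos h3]

/-- ★ **Trace formula of the model of record** at an index with `side_k ≥ 3`, every `m ≥ 2`: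
`Σ' sp k ^ m + (-1)^m Σ' sm k ^ m = diagCyclicTraceU ρ β_k m` (`= Tr K_u^m`, the twisted diagonal-torus partition function of hand-1), both summable. -/
theorem wilsonDiagonalTransferModel_trace (hβ : ∀ k, 0 ≤ sch.β k) (k : ℕ) (h3 : 3 ≤ sch.side k) (m : ℕ) [NeZero m] (hm : 2 ≤ m) :
    Summable (fun j => (wilsonDiagonalTransferModel r sch hβ).sp k j ^ m) ∧
      Summable (fun j => (wilsonDiagonalTransferModel r sch hβ).sm k j ^ m) ∧
      ∑' j, (wilsonDiagonalTransferModel r sch hβ).sp k j ^ m + (-1) ^ m * ∑' j, (wilsonDiagonalTransferModel r sch hβ).sm k j ^ m =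
        diagCyclicTraceU r.ρ (sch.β k) m (S := sch.side k) (G := G) := by
  show Summable (fun j => (pinnedSliceFields r sch hβ k).sp j ^ m) ∧ Summable (fun j => (pinnedSliceFields r sch hβ k).sm j ^ m) ∧
    ∑' j, (pinnedSliceFields r sch hβ k).sp j ^ m + (-1) ^ m * ∑' j, (pinnedSliceFields r sch hβ k).sm j ^ m = _
  rw [pinnedSliceFields_eq r sch hβ k h3]
  exact SlicePkg.toFields_trace r sch (hβ k) h3 _ m hm

/-- ★ **Even heat trace of the model of record**: `Σ' sp k ^ (2t+2) + Σ' sm k ^ (2t+2) = Tr K_u^{2t+2}` (every even exponent `≥ 2`; the quantity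
normalised by powers of `top_k` in the letters R2 `DiagLukewarm` / R2♭ `DiagTepid`). -/
theorem wilsonDiagonalTransferModel_evenTrace (hβ : ∀ k, 0 ≤ sch.β k) (k : ℕ) (h3 : 3 ≤ sch.side k) (t : ℕ) :
    ∑' j, (wilsonDiagonalTransferModel r sch hβ).sp k j ^ (2 * t + 2) + ∑' j, (wilsonDiagonalTransferModel r sch hβ).sm k j ^ (2 * t + 2) =
      diagCyclicTraceU r.ρ (sch.β k) (2 * t + 2) (S := sch.side k) (G := G) := by
  have h := (wilsonDiagonalTransferModel_trace r sch hβ k h3 (2 * t + 2) (by omega)).2.2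
  rwa [(show Even (2 * t + 2) from ⟨t + 1, by omega⟩).neg_one_pow, one_mul] at h

/-- ★ **Odd twisted trace of the model of record**: `Σ' sp k ^ m − Σ' sm k ^ m = Tr K_u^m` for odd `m ≥ 3` (the sign-twisted partition function;
at `m = side_k` it is Wilson's partition function of the own odd torus up to hand-1's constant). -/
theorem wilsonDiagonalTransferModel_oddTrace (hβ : ∀ k, 0 ≤ sch.β k) (k : ℕ) (h3 : 3 ≤ sch.side k) (m : ℕ) [NeZero m] (hm : 3 ≤ m)
    (hmo : Odd m) :
    ∑' j, (wilsonDiagonalTransferModel r sch hβ).sp k j ^ m - ∑' j, (wilsonDiagonalTransferModel r sch hβ).sm k j ^ m =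
      diagCyclicTraceU r.ρ (sch.β k) m (S := sch.side k) (G := G) := by
  have h := (wilsonDiagonalTransferModel_trace r sch hβ k h3 m (by omega)).2.2
  rwa [hmo.neg_one_pow, neg_one_mul, ← sub_eq_add_neg] at h

/-- One sign per index for the model of record (at `side_k ≥ 3`). -/
theorem wilsonDiagonalTransferModel_disjoint (hβ : ∀ k, 0 ≤ sch.β k) (k : ℕ) (h3 : 3 ≤ sch.side k) (j : ℕ) :
    (wilsonDiagonalTransferModel r sch hβ).sp k j = 0 ∨ (wilsonDiagonalTransferModel r sch hβ).sm k j = 0 := by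
  show (pinnedSliceFields r sch hβ k).sp j = 0 ∨ (pinnedSliceFields r sch hβ k).sm j = 0
  rw [pinnedSliceFields_eq r sch hβ k h3]
  exact SlicePkg.toFields_disjoint r sch (hβ k) h3 _ j

/-- **The top modulus is the greatest modulus** (by-name form of `top_attained` + `sp_le`/`sm_le`; holds at every index, the dummy slices included):
`top k` is the greatest element of `{max (sp k j) (sm k j) | j}`. -/
theorem wilsonDiagonalTransferModel_top_isGreatest (hβ : ∀ k, 0 ≤ sch.β k) (k : ℕ) :
    IsGreatest (Set.range fun j => max ((wilsonDiagonalTransferModel r sch hβ).sp k j) ((wilsonDiagonalTransferModel r sch hβ).sm k j))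
      ((wilsonDiagonalTransferModel r sch hβ).top k) := by
  refine ⟨?_, ?_⟩
  · obtain ⟨j, hj⟩ := (wilsonDiagonalTransferModel r sch hβ).top_attained k
    refine ⟨j, ?_⟩
    show max ((wilsonDiagonalTransferModel r sch hβ).sp k j) ((wilsonDiagonalTransferModel r sch hβ).sm k j) = _
    rcases hj with h | h
    · rw [max_eq_left (h.symm ▸ (wilsonDiagonalTransferModel r sch hβ).sm_le k j), h]
    · rw [max_eq_right (h.symm ▸ (wilsonDiagonalTransferModel r sch hβ).sp_le k j), h]
  · rintro x ⟨j, rfl⟩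
    exact max_le ((wilsonDiagonalTransferModel r sch hβ).sp_le k j) ((wilsonDiagonalTransferModel r sch hβ).sm_le k j)

/-- By-name form of the interface field `trace_nonneg` on the model of record: `Σ' sm k ^ m ≤ Σ' sp k ^ m` for odd `m ≥ 3` (`Tr K_u^m ≥ 0`). -/
theorem wilsonDiagonalTransferModel_odd_le (hβ : ∀ k, 0 ≤ sch.β k) (k m : ℕ) (hm : 3 ≤ m) (hmo : Odd m) :
    ∑' j, (wilsonDiagonalTransferModel r sch hβ).sm k j ^ m ≤ ∑' j, (wilsonDiagonalTransferModel r sch hβ).sp k j ^ m :=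
  (wilsonDiagonalTransferModel r sch hβ).trace_nonneg k m hm hmo

/-- By-name form of the interface field `trace_side_pos` on the model of record: `Σ' sm k ^ side_k < Σ' sp k ^ side_k` (`Z_k > 0`). -/
theorem wilsonDiagonalTransferModel_strict_side (hβ : ∀ k, 0 ≤ sch.β k) (k : ℕ) :
    ∑' j, (wilsonDiagonalTransferModel r sch hβ).sm k j ^ sch.side k < ∑' j, (wilsonDiagonalTransferModel r sch hβ).sp k j ^ sch.side k :=
  (wilsonDiagonalTransferModel r sch hβ).trace_side_pos k

end Rows

end Summit.QuantumFields.YangMills.Cruxes.DiagonalMirrorRPR.SignTwistedDiagonalTrace.WilsonDiagonal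

end
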